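import Literature.AnabelianGeometry.EtaleTheta.Discharge.Sec5Thm57

/-!
# [EtTh] §5 p.331 / Prop. 4.3 (i): existence and uniqueness of `s^⊓-gp_N`, `s^⊔-gp_N` from divisor invariance (pp. 316–317, 330–331 / PDF pp. 90–91, 104–105)

Mochizuki, *The étale theta function …*, Publ. RIMS **45** (2009)
[cite: MochizukiEtTh2009, Prop 4.3 (i) p.316–317 (PDF pp.90–91); §5 p.331 (PDF p.105)].  Seat abc-iut-L2-t4 (§5 owner);
PROOF-ONLY over the §5 data `ThetaFrobenioid` (FrobenioidTheta/…BiKummer, FROZEN) and abc-iut-L2-d4's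
`Discharge/Sec5Thm57.lean` (`exists_iso_of_div_eq`: [FrdI] Def. 1.3 (iii)(d) + total epimorphicity + isotropic type).

WHAT IS DISCHARGED.  §5 p.331 (PDF p.105): "Let `s^trv_N : Aut_D(A_N^bs) → Aut_C(A_N)` be the group homomorphism … arising
from a base-Frobenius pair of `A_N` … Thus, `s^trv_N` determines [unique] group homomorphisms
`s^⊓-gp_N : Aut_D(B_N^bs) → Aut_C(B_N)`; `s^⊔-gp_N : H_{B_N} → Aut_C(B_N)` [cf. Proposition 4.3, (i)] such that
`s^⊓-gp_N(g) ∘ s^⊓_N = s^⊓_N ∘ (s^trv_N|…)(g)`, `s^⊔-gp_N(h) ∘ s^⊔_N = s^⊔_N ∘ (s^trv_N|_{H_{B_N}})(h)`" — and the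
printed PROOF of that existence and uniqueness (Prop. 4.3 (i), p.317 (PDF p.91)): "it follows from the general theory
of Frobenioids — cf. the first equivalence of categories involving pre-steps of [FrdI], Definition 1.3, (iii), (d);
the fact that Frobenioids are always totally epimorphic — that it suffices to prove that `Div(s'_N)`, `Div(s''_N)`
`∈ Φ(A_N)` are fixed by `H_{A_N}`"; in §5 moreover "the zero divisor `Div(s^⊓_N)` … descends … to `Φ(A_⊚)`" (p.330
(PDF p.104)), so it is fixed by ALL of `Aut_C(A_N)` and `s^⊓-gp_N` is defined on the whole of `Aut_D(B_N^bs)` (whence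
"`B_N` is Aut-ample", `Discharge/Sec5AutAmple.lean`).  In abc-iut-L2-t4's typing `s^⊓-gp_N, s^⊔-gp_N` are DATA
(`ThetaFrobenioid.sgpCap/sgpCup`) with the printed defining relations as named inputs `SgpCapSpec`, `SgpCupSpec` and
uniqueness PROVED (`sgpUnique_of`).  Here, GENERICALLY for a group `G` acting on `A_N` through `σ : G → Aut_C(A_N)`
and a pre-step `s : A_N → B_N` whose zero divisor is `σ(G)`-fixed (`hdiv`, the printed sufficient condition, stated
as `Div(σ(g) ∘ s) = Div(s)`), the homomorphism `G → Aut_C(B_N)` with `x(g) ∘ s = s ∘ σ(g)` EXISTS and is UNIQUE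
(`liftAlong`, `liftAlong_spec`, `liftAlong_unique`); specialised: `existsUnique_sgpCapShape` (`G = Aut_D(B_N^bs)`,
`σ = s^trv_N ∘ (Aut_D(A_N^bs) ⥲ Aut_D(B_N^bs))⁻¹`, `s = s^⊓_N`) and `existsUnique_sgpCupShape` (`G = H_{B_N}`,
`s = s^⊔_N`), and the data `𝔉.sgpCap`, `𝔉.sgpCup` ARE these unique homomorphisms as soon as `SgpCapSpec`,
`SgpCupSpec` hold (`sgpCap_eq_liftAlong`, `sgpCup_eq_liftAlong`).  HONEST FRAMING: kernel-checked implications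
between typed statements about the §5 data; inputs = [FrdI] Def. 1.3 (total epimorphicity; (iii)(d) coslice-full),
[EtTh] Thm. 3.7 (i) (isotropic type), and the divisor-invariance clauses; nothing of [EtTh] is asserted
unconditionally; no side is taken on anything downstream. -/

namespace Literature.AnabelianGeometry.EtaleTheta

open CategoryTheory

universe w v v' u u'

namespace ThetaFrobenioid

variable {C : Type u} [Category.{v} C] {D : Type u'} [Category.{v'} D] {𝔉 : ThetaFrobenioid.{w} C D}

section Generic

variable (hepi : ∀ ⦃X Y : C⦄ (f : X ⟶ Y), Epi f) (hiso : 𝔉.pre.IsOfIsotropicType)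
  (hiiid : ∀ ⦃A B B' : C⦄ (φ : A ⟶ B) (φ' : A ⟶ B'), 𝔉.pre.IsCoAngularPreStep φ →
    𝔉.pre.IsCoAngularPreStep φ' → 𝔉.pre.div φ ∣ 𝔉.pre.div φ' →
      ∃ f : B ⟶ B', 𝔉.pre.IsCoAngularPreStep f ∧ φ ≫ f = φ')

include hepi hiso hiiid

/-- **The lifting step of Prop. 4.3 (i)** (p.317 (PDF p.91): "[FrdI] Def. 1.3 (iii)(d) … totally epimorphic … it
suffices to prove that `Div(s_N)` … [is] fixed"): for a pre-step `s : A → B` and an automorphism `y` of `A` with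
`Div(y ∘ s) = Div(s)` there is a UNIQUE automorphism `x` of `B` with `x ∘ s = s ∘ y` (diagrammatic: `s ≫ x = y ≫ s`).
[cite: MochizukiEtTh2009, Prop 4.3 (i) proof p.317 (PDF p.91)] -/
theorem existsUnique_aut_comp_eq {A B : C} {s : A ⟶ B} (hs : 𝔉.IsPreStep s) (y : Aut A)
    (hdiv : 𝔉.pre.div (y.hom ≫ s) = 𝔉.pre.div s) : ∃! x : Aut B, s ≫ x.hom = y.hom ≫ s := by
  obtain ⟨f, hf⟩ := exists_iso_of_div_eq hepi hiso hiiid hs (isPreStep_iso_hom_comp y hs) hdiv.symm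
  refine ⟨f, hf, fun x hx => ?_⟩
  haveI := hepi s
  exact Aut.ext ((cancel_epi s).mp (hx.trans hf.symm))

variable {G : Type*} [Group G] {A B : C} (σ : G →* Aut A) {s : A ⟶ B} (hs : 𝔉.IsPreStep s)
  (hdiv : ∀ g : G, 𝔉.pre.div ((σ g).hom ≫ s) = 𝔉.pre.div s)

include hs hdiv

/-- **The homomorphism determined by a divisor-fixing action** (Prop. 4.3 (i), p.316–317 (PDF pp.90–91); §5 p.331 (PDF
p.105) "`s^trv_N` determines [unique] group homomorphisms …"): for `σ : G → Aut_C(A)` fixing `Div(s)` (`hdiv`), the map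
`g ↦` the unique `x ∈ Aut_C(B)` with `x ∘ s = s ∘ σ(g)` — a group homomorphism by uniqueness.
[cite: MochizukiEtTh2009, Prop 4.3 (i) p.316–317 (PDF pp.90–91); §5 p.331 (PDF p.105)] -/
noncomputable def liftAlong : G →* Aut B where
  toFun g := (existsUnique_aut_comp_eq hepi hiso hiiid hs (σ g) (hdiv g)).choose
  map_one' := by
    have h : s ≫ (Exists.choose (existsUnique_aut_comp_eq hepi hiso hiiid hs (σ 1) (hdiv 1))).hom =
        (σ 1).hom ≫ s :=
      (existsUnique_aut_comp_eq hepi hiso hiiid hs (σ 1) (hdiv 1)).choose_spec.1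
    haveI := hepi s
    apply Aut.ext
    apply (cancel_epi s).mp
    rw [h, map_one]
    change (Iso.refl A).hom ≫ s = s ≫ (Iso.refl B).hom
    simp
  map_mul' g g' := by
    have hgg : s ≫ (Exists.choose (existsUnique_aut_comp_eq hepi hiso hiiid hs (σ (g * g'))
        (hdiv (g * g')))).hom = (σ (g * g')).hom ≫ s :=
      (existsUnique_aut_comp_eq hepi hiso hiiid hs (σ (g * g')) (hdiv (g * g'))).choose_spec.1
    have hg : s ≫ (Exists.choose (existsUnique_aut_comp_eq hepi hiso hiiid hs (σ g) (hdiv g))).hom =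
        (σ g).hom ≫ s :=
      (existsUnique_aut_comp_eq hepi hiso hiiid hs (σ g) (hdiv g)).choose_spec.1
    have hg' : s ≫ (Exists.choose (existsUnique_aut_comp_eq hepi hiso hiiid hs (σ g') (hdiv g'))).hom =
        (σ g').hom ≫ s :=
      (existsUnique_aut_comp_eq hepi hiso hiiid hs (σ g') (hdiv g')).choose_spec.1
    haveI := hepi s
    apply Aut.ext
    apply (cancel_epi s).mp
    rw [hgg, map_mul, Aut.Aut_mul_def, Aut.Aut_mul_def, Iso.trans_hom, Iso.trans_hom, Category.assoc,
      ← Category.assoc s, hg', Category.assoc, hg]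

/-- The defining relation of `liftAlong`: `x(g) ∘ s = s ∘ σ(g)`.
[cite: MochizukiEtTh2009, Prop 4.3 (i) p.316 (PDF p.90); §5 p.331 (PDF p.105)] -/
theorem liftAlong_spec (g : G) : s ≫ (liftAlong hepi hiso hiiid σ hs hdiv g).hom = (σ g).hom ≫ s :=
  show s ≫ (Exists.choose (existsUnique_aut_comp_eq hepi hiso hiiid hs (σ g) (hdiv g))).hom = (σ g).hom ≫ s from
    (existsUnique_aut_comp_eq hepi hiso hiiid hs (σ g) (hdiv g)).choose_spec.1

/-- UNIQUENESS (p.331 (PDF p.105) "unique group homomorphisms"; totally epimorphic): any homomorphism with the defining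
relation is `liftAlong`.  [cite: MochizukiEtTh2009, Prop 4.3 (i) p.316–317 (PDF pp.90–91); §5 p.331 (PDF p.105)] -/
theorem liftAlong_unique (a : G →* Aut B) (ha : ∀ g, s ≫ (a g).hom = (σ g).hom ≫ s) :
    a = liftAlong hepi hiso hiiid σ hs hdiv := by
  ext g : 1
  exact (existsUnique_aut_comp_eq hepi hiso hiiid hs (σ g) (hdiv g)).unique (ha g)
    (liftAlong_spec hepi hiso hiiid σ hs hdiv g)

/-- Existence AND uniqueness packaged.  [cite: MochizukiEtTh2009, Prop 4.3 (i) p.316–317 (PDF pp.90–91)] -/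
theorem existsUnique_hom_comp_eq : ∃! a : G →* Aut B, ∀ g, s ≫ (a g).hom = (σ g).hom ≫ s :=
  ⟨liftAlong hepi hiso hiiid σ hs hdiv, liftAlong_spec hepi hiso hiiid σ hs hdiv,
    fun a ha => liftAlong_unique hepi hiso hiiid σ hs hdiv a ha⟩

end Generic

section Theta

variable (𝔉)
variable (hepi : ∀ ⦃X Y : C⦄ (f : X ⟶ Y), Epi f) (hiso : 𝔉.pre.IsOfIsotropicType)
  (hiiid : ∀ ⦃A B B' : C⦄ (φ : A ⟶ B) (φ' : A ⟶ B'), 𝔉.pre.IsCoAngularPreStep φ →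
    𝔉.pre.IsCoAngularPreStep φ' → 𝔉.pre.div φ ∣ 𝔉.pre.div φ' →
      ∃ f : B ⟶ B', 𝔉.pre.IsCoAngularPreStep f ∧ φ ≫ f = φ')

include hepi hiso hiiid

/-- **`s^⊓-gp_N` exists and is unique** (§5 p.331 (PDF p.105); Prop. 4.3 (i)): if `Div(s^⊓_N)` is fixed by the `s^trv_N`-image
of `Aut_D(A_N^bs)` (`hdiv` — print: "the zero divisor `Div(s^⊓_N)` … descends … to `Φ(A_⊚)`", p.330 (PDF p.104), so it is
fixed by every automorphism), there is exactly one homomorphism `Aut_D(B_N^bs) → Aut_C(B_N)` with the defining relation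
`SgpCapSpec`'s shape.  [cite: MochizukiEtTh2009, §5 p.330–331 (PDF pp.104–105); Prop 4.3 (i) p.316–317 (PDF pp.90–91)] -/
theorem existsUnique_sgpCapShape
    (hdiv : ∀ g : Aut (𝔉.base.obj 𝔉.BN),
      𝔉.pre.div ((𝔉.strv (𝔉.autBaseIsoAB.symm g)).hom ≫ 𝔉.sCap) = 𝔉.pre.div 𝔉.sCap) :
    ∃! a : Aut (𝔉.base.obj 𝔉.BN) →* Aut 𝔉.BN,
      ∀ g, 𝔉.sCap ≫ (a g).hom = (𝔉.strv (𝔉.autBaseIsoAB.symm g)).hom ≫ 𝔉.sCap :=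
  existsUnique_hom_comp_eq hepi hiso hiiid (𝔉.strv.comp 𝔉.autBaseIsoAB.symm.toMonoidHom) 𝔉.isPreStep_sCap hdiv

/-- **`s^⊔-gp_N` exists and is unique on `H_{B_N}`** (§5 p.331 (PDF p.105); Prop. 4.3 (i)): if `Div(s^⊔_N)` is fixed by the
`s^trv_N`-image of `H_{B_N}` (`hdiv` — print p.317 (PDF p.91): "`N · Div(s''_N)` … arise[s] as pull-back … of `Div(s'')` …
`H` acts trivially on `A_⊚^bs`"), there is exactly one homomorphism `H_{B_N} → Aut_C(B_N)` with `SgpCupSpec`'s shape.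
[cite: MochizukiEtTh2009, §5 p.331 (PDF p.105); Prop 4.3 (i) p.316–317 (PDF pp.90–91)] -/
theorem existsUnique_sgpCupShape
    (hdiv : ∀ h : 𝔉.HB,
      𝔉.pre.div ((𝔉.strv (𝔉.autBaseIsoAB.symm (h : Aut (𝔉.base.obj 𝔉.BN)))).hom ≫ 𝔉.sCup) =
        𝔉.pre.div 𝔉.sCup) :
    ∃! b : 𝔉.HB →* Aut 𝔉.BN,
      ∀ h : 𝔉.HB, 𝔉.sCup ≫ (b h).hom = (𝔉.strv (𝔉.autBaseIsoAB.symm (h : Aut (𝔉.base.obj 𝔉.BN)))).hom ≫ 𝔉.sCup :=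
  existsUnique_hom_comp_eq hepi hiso hiiid ((𝔉.strv.comp 𝔉.autBaseIsoAB.symm.toMonoidHom).comp 𝔉.HB.subtype)
    𝔉.isPreStep_sCup hdiv

/-- The §5 datum `s^⊓-gp_N` IS the unique lift, given its printed defining relation `SgpCapSpec` (the named input is thereby
reduced to: the datum was chosen as print prescribes).  [cite: MochizukiEtTh2009, §5 p.331 (PDF p.105)] -/
theorem sgpCap_eq_liftAlong (hcap : 𝔉.SgpCapSpec)
    (hdiv : ∀ g : Aut (𝔉.base.obj 𝔉.BN),
      𝔉.pre.div ((𝔉.strv (𝔉.autBaseIsoAB.symm g)).hom ≫ 𝔉.sCap) = 𝔉.pre.div 𝔉.sCap) :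
    𝔉.sgpCap = liftAlong hepi hiso hiiid (𝔉.strv.comp 𝔉.autBaseIsoAB.symm.toMonoidHom) 𝔉.isPreStep_sCap hdiv :=
  liftAlong_unique hepi hiso hiiid _ 𝔉.isPreStep_sCap hdiv 𝔉.sgpCap hcap

/-- The §5 datum `s^⊔-gp_N` IS the unique lift on `H_{B_N}`, given `SgpCupSpec`.  [cite: MochizukiEtTh2009, §5 p.331 (PDF p.105)] -/
theorem sgpCup_eq_liftAlong (hcup : 𝔉.SgpCupSpec)
    (hdiv : ∀ h : 𝔉.HB,
      𝔉.pre.div ((𝔉.strv (𝔉.autBaseIsoAB.symm (h : Aut (𝔉.base.obj 𝔉.BN)))).hom ≫ 𝔉.sCup) =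
        𝔉.pre.div 𝔉.sCup) :
    𝔉.sgpCup = liftAlong hepi hiso hiiid ((𝔉.strv.comp 𝔉.autBaseIsoAB.symm.toMonoidHom).comp 𝔉.HB.subtype)
      𝔉.isPreStep_sCup hdiv :=
  liftAlong_unique hepi hiso hiiid _ 𝔉.isPreStep_sCup hdiv 𝔉.sgpCup hcup

/-- Conversely the defining relations HOLD for the lifts: `SgpCapSpec`-shape and `SgpCupSpec`-shape are satisfied by
`liftAlong` — so over §5 data in which `sgpCap`, `sgpCup` are DEFINED as these lifts (MERGE-PLAN §2a) the named inputs
`SgpCapSpec`, `SgpCupSpec` become theorems.  [cite: MochizukiEtTh2009, §5 p.331 (PDF p.105)] -/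
theorem sgpSpecs_of_liftAlong
    (hdivc : ∀ g : Aut (𝔉.base.obj 𝔉.BN),
      𝔉.pre.div ((𝔉.strv (𝔉.autBaseIsoAB.symm g)).hom ≫ 𝔉.sCap) = 𝔉.pre.div 𝔉.sCap)
    (hdivp : ∀ h : 𝔉.HB,
      𝔉.pre.div ((𝔉.strv (𝔉.autBaseIsoAB.symm (h : Aut (𝔉.base.obj 𝔉.BN)))).hom ≫ 𝔉.sCup) =
        𝔉.pre.div 𝔉.sCup)
    (hc : 𝔉.sgpCap = liftAlong hepi hiso hiiid (𝔉.strv.comp 𝔉.autBaseIsoAB.symm.toMonoidHom) 𝔉.isPreStep_sCap hdivc)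
    (hp : 𝔉.sgpCup = liftAlong hepi hiso hiiid ((𝔉.strv.comp 𝔉.autBaseIsoAB.symm.toMonoidHom).comp 𝔉.HB.subtype)
      𝔉.isPreStep_sCup hdivp) :
    𝔉.SgpCapSpec ∧ 𝔉.SgpCupSpec :=
  ⟨fun g => by rw [hc]; exact liftAlong_spec hepi hiso hiiid _ 𝔉.isPreStep_sCap hdivc g,
    fun h => by rw [hp]; exact liftAlong_spec hepi hiso hiiid _ 𝔉.isPreStep_sCup hdivp h⟩

end Theta

end ThetaFrobenioid

end Literature.AnabelianGeometry.EtaleTheta
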